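import Summits.AtomisticToContinuum.Crystallization.Theorems.GappedShellCensusCleanLimitsHaveWindowsBoxPinningC
import Literature.MathematicalPhysics.StatisticalMechanics.MuGroundStateConfiguration

/-!
# Vertical pinning, part 1: recurrence of the increments from rooted uniform recurrence

Helper for the registered stub `stub_verticalPinning` (T4b-iv) of line `Sketch` of the crux
`GappedShellCensus.CleanLimitsHaveWindows` (stmt-AtomisticToContinuum-15932).

For an exactly layered set `Z = v + A(S(a', s, z))` whose increments `Δ_m = z(m+1) − z m` lie in `[p, q]`
with `q < 2p`, rooted uniform recurrence of the point set (every `(R, ε)`-patch of `Z` about the origin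
reappears up to `ε` about a point of `Z` within distance `G` of every point of `Z`) implies the recurrence
of every single increment with bounded gaps: for all `η > 0` and `m₀` there is `G` such that every `m` sees
`|Δ_{m+g} − Δ_{m₀}| ≤ η` for some `0 ≤ g ≤ G` (`vp_recurrence`). The heights are read off through the
linear functional `p ↦ (A⁻¹ p)₃`, which is `1`-Lipschitz and takes the value `z m + const` at the sites of
layer `m`; two sites one increment apart are matched to two sites whose height difference is within `2ε`
of that increment, hence consecutive (`q + 2ε < 2p`). [folklore]
-/

noncomputable section

namespace Summit.AtomisticToContinuum.Crystallization.Theorems.CleanHull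

open Filter Literature.MathematicalPhysics.StatisticalMechanics Literature.Geometry.DiscreteGeometry

/-! ## Heights and layer indices -/

/-- Height differences dominate index differences: `p |n' − n| ≤ |z n' − z n|`. [folklore] -/
theorem vp_index_le {z : ℤ → ℝ} {p : ℝ} (hp : 0 ≤ p) (hz : ∀ m : ℤ, p ≤ z (m + 1) - z m) (n n' : ℤ) :
    p * |((n' : ℝ) - n)| ≤ |z n' - z n| := by
  have h := LayeredHull.cake_abs_height_diff_ge (50 / 39 * p) (by positivity) z
    (fun m => by have := hz m; linarith) n n'
  have e : 39 / 50 * (50 / 39 * p) = p := by ring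
  rwa [e] at h

/-- A height difference in `(0, 2p)` is one increment. [folklore] -/
theorem vp_index_succ {z : ℤ → ℝ} {p : ℝ} (hp : 0 < p) (hz : ∀ m : ℤ, p ≤ z (m + 1) - z m) {n n' : ℤ}
    (h0 : 0 < z n' - z n) (h2 : z n' - z n < 2 * p) : n' = n + 1 := by
  have hmono : StrictMono z := strictMono_int_of_lt_succ fun m => by linarith [hz m]
  have hlt : n < n' := hmono.lt_iff_lt.1 (by linarith)
  by_contra hne
  have h2' : n + 1 + 1 ≤ n' := by omega
  have ha := hz n
  have hb := hz (n + 1)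
  have hmn : z (n + 1 + 1) ≤ z n' := hmono.monotone h2'
  linarith

/-! ## The height functional -/

/-- The height functional `p ↦ (A⁻¹ p)₃` is `1`-Lipschitz. [folklore] -/
theorem vp_height_lipschitz (A : EuclideanSpace ℝ (Fin 3) →ₗᵢ[ℝ] EuclideanSpace ℝ (Fin 3))
    (u u' : EuclideanSpace ℝ (Fin 3)) :
    |(A.toLinearIsometryEquiv rfl).symm u 2 - (A.toLinearIsometryEquiv rfl).symm u' 2| ≤ dist u u' := by
  set Ae := A.toLinearIsometryEquiv rfl
  have e : Ae.symm u 2 - Ae.symm u' 2 = (Ae.symm (u - u')) 2 := by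
    rw [map_sub]; rfl
  rw [e, dist_eq_norm, ← Ae.symm.norm_map (u - u'), ← Real.norm_eq_abs]
  exact PiLp.norm_apply_le _ 2

/-- The height functional at a site of layer `t.1` is `z t.1 + (A⁻¹ v)₃`. [folklore] -/
theorem vp_height_site (A : EuclideanSpace ℝ (Fin 3) →ₗᵢ[ℝ] EuclideanSpace ℝ (Fin 3)) (a' : ℝ)
    (s : ℤ → ℤ) (z : ℤ → ℝ) (v : EuclideanSpace ℝ (Fin 3)) (t : ℤ × ℤ × ℤ) :
    (A.toLinearIsometryEquiv rfl).symm (bpSite A a' s z v t) 2 =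
      z t.1 + (A.toLinearIsometryEquiv rfl).symm v 2 := by
  set Ae := A.toLinearIsometryEquiv rfl
  have hAe : ∀ p, Ae p = A p := fun p => rfl
  unfold bpSite
  rw [map_add, ← hAe, Ae.symm_apply_apply]
  simp

/-! ## Recurrence of the increments -/

/-- **Recurrence of the increments.** For an exactly layered set `Z = v + A(S(a', s, z))` with increments in
`[p, q]`, `0 < p`, `q < 2p`, rooted uniform recurrence of `Z` implies: for all `η > 0` and `m₀` there is
`G` such that for every `m` some `0 ≤ g ≤ G` has `|Δ_{m+g} − Δ_{m₀}| ≤ η`. [folklore] -/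
theorem vp_recurrence (A : EuclideanSpace ℝ (Fin 3) →ₗᵢ[ℝ] EuclideanSpace ℝ (Fin 3)) (a' : ℝ)
    (s : ℤ → ℤ) (z : ℤ → ℝ) (v : EuclideanSpace ℝ (Fin 3)) (Z : Set (EuclideanSpace ℝ (Fin 3)))
    (hZ : Z = (fun p => p + v) '' {p : EuclideanSpace ℝ (Fin 3) | ∃ m i j : ℤ,
        p = A (((i : ℝ) • triangularVec₁ a') + ((j : ℝ) • triangularVec₂ a') +
          ((haggLabel s m : ℝ) • barlowOffset a') + (z m • layerNormal 1))})
    (p q : ℝ) (hp : 0 < p) (hpq : q < 2 * p)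
    (hz : ∀ m : ℤ, p ≤ z (m + 1) - z m ∧ z (m + 1) - z m ≤ q)
    (hrec : ∀ R ε : ℝ, 0 < ε → ∃ G : ℝ, ∀ w ∈ Z, ∃ g ∈ Z, dist g w ≤ G ∧
      BallMatch ε R 0 ((fun p => p - g) '' Z) Z) :
    ∀ η : ℝ, 0 < η → ∀ m₀ : ℤ, ∃ G : ℕ, ∀ m : ℤ, ∃ g : ℤ, 0 ≤ g ∧ g ≤ G ∧
      |(z (m + g + 1) - z (m + g)) - (z (m₀ + 1) - z m₀)| ≤ η := by
  intro η hη m₀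
  set Ae := A.toLinearIsometryEquiv rfl with hAe_def
  set φ : EuclideanSpace ℝ (Fin 3) → ℝ := fun u => Ae.symm u 2 with hφ
  have hφsite : ∀ t : ℤ × ℤ × ℤ, φ (bpSite A a' s z v t) = z t.1 + φ v := fun t =>
    vp_height_site A a' s z v t
  have hφlip : ∀ u u', |φ u - φ u'| ≤ dist u u' := fun u u' => vp_height_lipschitz A u u'
  have hφsub : ∀ u u', φ (u - u') = φ u - φ u' := fun u u' => by
    simp only [hφ, map_sub]; rfl
  have hzl : ∀ m : ℤ, p ≤ z (m + 1) - z m := fun m => (hz m).1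
  have hpq' : p ≤ q := by have := hz 0; linarith [this.1, this.2]
  -- the two reference sites and the matching data
  set p₀ := bpSite A a' s z v (m₀, 0, 0) with hp₀
  set p₁ := bpSite A a' s z v (m₀ + 1, 0, 0) with hp₁
  set R : ℝ := max ‖p₀‖ ‖p₁‖ with hR
  set ε : ℝ := min (η / 2) ((2 * p - q) / 3) with hε
  have hε0 : 0 < ε := lt_min (by linarith) (by linarith)
  have hεη : 2 * ε ≤ η := by have := min_le_left (η / 2) ((2 * p - q) / 3); linarith
  have hεp : q + 2 * ε < 2 * p := by have := min_le_right (η / 2) ((2 * p - q) / 3); linarith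
  have hεp' : 2 * ε < p := by linarith
  obtain ⟨G, hG⟩ := hrec R ε hε0
  -- the index window
  set K₀ : ℝ := |z m₀ + φ v| + ε with hK₀
  set M : ℕ := ⌈(max G 0 + K₀) / p⌉₊ + 1 with hM
  have hMbound : (max G 0 + K₀) / p < M := by
    rw [hM]; push_cast
    linarith [Nat.le_ceil ((max G 0 + K₀) / p)]
  refine ⟨2 * M, fun m => ?_⟩
  -- recurrence about the site of layer `m + M`
  set w := bpSite A a' s z v (m + M, 0, 0) with hw
  obtain ⟨g, hgZ, hgw, hBM⟩ := hG w (bp_site_mem hZ (m + M, 0, 0))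
  obtain ⟨tg, rfl⟩ := (bp_mem_iff hZ).1 hgZ
  -- partners of the two reference sites
  have hp₀R : dist p₀ 0 ≤ R := by rw [dist_zero_right]; exact le_max_left _ _
  have hp₁R : dist p₁ 0 ≤ R := by rw [dist_zero_right]; exact le_max_right _ _
  obtain ⟨a₀, ha₀, hd₀⟩ := hBM.1 p₀ (bp_site_mem hZ (m₀, 0, 0)) hp₀R
  obtain ⟨a₁, ha₁, hd₁⟩ := hBM.1 p₁ (bp_site_mem hZ (m₀ + 1, 0, 0)) hp₁R
  obtain ⟨u₀, hu₀, rfl⟩ := ha₀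
  obtain ⟨u₁, hu₁, rfl⟩ := ha₁
  obtain ⟨t₀, rfl⟩ := (bp_mem_iff hZ).1 hu₀
  obtain ⟨t₁, rfl⟩ := (bp_mem_iff hZ).1 hu₁
  -- heights
  have E0 : |(z t₀.1 - z tg.1) - (z m₀ + φ v)| ≤ ε := by
    have h := hφlip (bpSite A a' s z v t₀ - bpSite A a' s z v tg) p₀
    rw [hφsub, hφsite, hφsite, hp₀, hφsite] at h
    simp only at h
    refine le_trans (le_of_eq ?_) (h.trans hd₀)
    congr 1; ring
  have E1 : |(z t₁.1 - z tg.1) - (z (m₀ + 1) + φ v)| ≤ ε := by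
    have h := hφlip (bpSite A a' s z v t₁ - bpSite A a' s z v tg) p₁
    rw [hφsub, hφsite, hφsite, hp₁, hφsite] at h
    simp only at h
    refine le_trans (le_of_eq ?_) (h.trans hd₁)
    congr 1; ring
  have E01 : |(z t₁.1 - z t₀.1) - (z (m₀ + 1) - z m₀)| ≤ 2 * ε := by
    have e : (z t₁.1 - z t₀.1) - (z (m₀ + 1) - z m₀) =
        ((z t₁.1 - z tg.1) - (z (m₀ + 1) + φ v)) - ((z t₀.1 - z tg.1) - (z m₀ + φ v)) := by ring
    rw [e]
    refine (abs_sub _ _).trans ?_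
    linarith
  -- the partners are consecutive layers
  have hsucc : t₁.1 = t₀.1 + 1 := by
    have hΔ := hz m₀
    have hab := abs_le.1 E01
    exact vp_index_succ hp hzl (by linarith [hab.1, hΔ.1]) (by linarith [hab.2, hΔ.2])
  -- the index of the partner layer relative to `m`
  have hidx : |((t₀.1 : ℝ) - (m + M))| < M := by
    have h1 : |z t₀.1 - z tg.1| ≤ K₀ := by
      have := abs_sub_abs_le_abs_sub (z t₀.1 - z tg.1) (z m₀ + φ v)
      rw [hK₀]; linarith
    have h2 : |z tg.1 - z (m + M)| ≤ max G 0 := by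
      have h := hφlip (bpSite A a' s z v tg) w
      rw [hφsite, hw, hφsite] at h
      simp only at h
      rw [show z tg.1 + φ v - (z (m + M) + φ v) = z tg.1 - z (m + M) by ring] at h
      exact h.trans (hgw.trans (le_max_left _ _))
    have h3 : |z t₀.1 - z (m + M)| ≤ max G 0 + K₀ := by
      have e : z t₀.1 - z (m + M) = (z t₀.1 - z tg.1) + (z tg.1 - z (m + M)) := by ring
      rw [e]; refine (abs_add_le _ _).trans ?_; linarith
    have h4 := vp_index_le hp.le hzl (m + M) t₀.1
    push_cast at h4
    have h5 : p * |((t₀.1 : ℝ) - (m + M))| ≤ max G 0 + K₀ := h4.trans h3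
    by_contra hcon
    have hcon' : (M : ℝ) ≤ |((t₀.1 : ℝ) - (m + M))| := not_lt.1 hcon
    have : p * (M : ℝ) ≤ max G 0 + K₀ := le_trans (mul_le_mul_of_nonneg_left hcon' hp.le) h5
    rw [div_lt_iff₀ hp] at hMbound
    linarith
  have hlow : ((m : ℤ) : ℝ) < (t₀.1 : ℝ) := by linarith [(abs_lt.1 hidx).1]
  have hlow' : m < t₀.1 := by exact_mod_cast hlow
  have hup : (t₀.1 : ℝ) < ((m + 2 * (M : ℤ) : ℤ) : ℝ) := by push_cast; linarith [(abs_lt.1 hidx).2]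
  have hup' : t₀.1 < m + 2 * (M : ℤ) := by exact_mod_cast hup
  refine ⟨t₀.1 - m, by omega, by push_cast; omega, ?_⟩
  rw [show m + (t₀.1 - m) = t₀.1 by ring, ← hsucc]
  exact E01.trans hεη

end Summit.AtomisticToContinuum.Crystallization.Theorems.CleanHull

end
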